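import Mathlib
import HarnessLib
import Summits.HubbardSuperconductivity.HubbardSuperconductivity.Theorems.KLProgrammeThermalGreenHighFrequency
import Literature.MathematicalPhysics.QuantumLattice.GibbsTwoTimeBound
import Literature.MathematicalPhysics.QuantumLattice.DuhamelTwoPoint

/-!
# LEHMANN DECAY of fermionic Matsubara transforms of thermal AUTOCORRELATIONS:
# `‖∫₀^β e^{ikτ}⟨A(τ)Aᴴ⟩_β dτ‖ ≤ 2‖A‖²/|k|` — NO commutator, uniform in the system size
# (seat hubbard-kl-k3c5-p1 g5, technique «stub_asm_matsubara suppliers»; VL child `KLRegimeVolumeLimitV14`, stmt-HubbardSuperconductivity-19921)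

`…ThermalGreenHighFrequency` (k3c5-p2) bounds `∫₀^β e^{ikτ}⟨A(τ)B⟩dτ` by Matsubara integrations by parts; every gained power of `1/k` costs a
commutator norm `‖[H,A]‖`, which for composite (dressed) modes is not obviously volume-uniform.  For an AUTOCORRELATION (`B = Aᴴ`) one power of
`1/k` is FREE: in the eigenbasis of the Hermitian `H` (`λ`, `U`; `a = U⋆AU`) the two-time function is a POSITIVE combination of exponentials,

  `⟨A(τ)Aᴴ⟩_β = Z⁻¹ Σ_{ij} |a_{ij}|² e^{−(β−τ)λ_i − τλ_j}`   (`lehmann_autocorrelation`),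

so at a fermionic frequency (`e^{ikβ} = −1`) the Matsubara transform is the Lehmann sum

  `∫₀^β e^{ikτ}⟨A(τ)Aᴴ⟩_β dτ = −Z⁻¹ Σ_{ij} |a_{ij}|² (e^{−βλ_i} + e^{−βλ_j}) / (ik + λ_i − λ_j)`   (`matsubara_autocorrelation_eq_lehmann`),

whose spectral weights are NONNEGATIVE with total mass `Z⁻¹Σ|a_{ij}|²(e^{−βλ_i}+e^{−βλ_j}) = ⟨AAᴴ⟩ + ⟨AᴴA⟩ ≤ 2‖A‖²`; since `|ik + Δ| ≥ |k|`,

  **`‖∫₀^β e^{ikτ}⟨A(τ)Aᴴ⟩_β dτ‖ ≤ 2‖A‖²/|k|`**   (`norm_matsubara_autocorrelation_le`).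

This is the first-moment sum rule with a remainder controlled by POSITIVITY instead of a commutator (Bratteli–Robinson II §5.3.1; the Lehmann /
Källén–Lehmann representation of thermal Green functions).  Use (this seat's `…VolumeLimitSixHamiltonian`): the VL child's six-point scalar is
`Six∞_L(n,p) = −∫₀^β e^{ik₀τ}⟨T′(τ)T′ᴴ⟩` with `‖T′‖ ≤ 3/2` uniformly in `L`, hence `‖Six∞_L(n,p)‖ ≤ (9/2)/|k₀(n)|` uniformly in the volume AND the
coupling — LABEL DECAY, the input of a «per-label two-volume rates ⇒ label-uniform rate» reduction of `stub_vl_carrierRate`.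
Everything is proved; no definition.
-/

noncomputable section

namespace Summit.HubbardSuperconductivity.HubbardSuperconductivity.Theorems.ThermalGreen

set_option linter.dupNamespace false -- summit = problem name (single-conjunct summit), D-0017

open scoped Matrix.Norms.L2Operator ComplexConjugate ComplexOrder
open Matrix Complex MeasureTheory intervalIntegral Finset Literature.MathematicalPhysics.QuantumLattice Literature.Probability.LatticeModels

variable {n : Type*} [Fintype n] [DecidableEq n] {H : Matrix n n ℂ}

/-! ## §1 The two-time autocorrelation in the eigenbasis (pointwise Lehmann formula) -/

/-- `U⋆ Aᴴ U = (U⋆ A U)ᴴ` for the eigenvector unitary. -/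
theorem star_mul_conjTranspose_mul_eq (hH : H.IsHermitian) (A : Matrix n n ℂ) :
    (star hH.eigenvectorUnitary : Matrix n n ℂ) * Aᴴ * (hH.eigenvectorUnitary : Matrix n n ℂ) =
      ((star hH.eigenvectorUnitary : Matrix n n ℂ) * A * (hH.eigenvectorUnitary : Matrix n n ℂ))ᴴ := by
  rw [Matrix.star_eq_conjTranspose, conjTranspose_mul, conjTranspose_mul, conjTranspose_conjTranspose, Matrix.mul_assoc]

/-- Inside the Gibbs weight the evolved autocorrelation recombines: `e^{−βH}·(e^{τH}Ae^{−τH})·Aᴴ = e^{−(β−τ)H} A e^{−τH} Aᴴ` (as a trace). -/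
theorem gibbsState_imagTimeEvolve_mul_eq_inv_mul_trace (β τ : ℝ) (A B : Matrix n n ℂ) :
    gibbsState β H (imagTimeEvolve H (τ : ℂ) A * B) =
      (partitionFn β H)⁻¹ * (gibbsWeight (β - τ) H * A * gibbsWeight τ H * B).trace := by
  have hw : gibbsWeight β H * NormedSpace.exp ((τ : ℂ) • H) = gibbsWeight (β - τ) H := by
    rw [gibbsWeight, gibbsWeight, ← Matrix.exp_add_of_commute _ _ (((Commute.refl H).smul_left _).smul_right _), ← add_smul]
    congr 1
    push_cast
    ring
  rw [gibbsState_apply, imagTimeEvolve_eq,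
    show gibbsWeight β H * (NormedSpace.exp ((τ : ℂ) • H) * A * NormedSpace.exp (-((τ : ℂ) • H)) * B) =
      gibbsWeight β H * NormedSpace.exp ((τ : ℂ) • H) * A * gibbsWeight τ H * B by
        simp only [gibbsWeight, neg_smul, Matrix.mul_assoc], hw]

/-- **Pointwise Lehmann formula for an autocorrelation**: with `a = U⋆AU` and the eigenvalues `λ` of the Hermitian `H`,
`⟨A(τ)Aᴴ⟩_β = Z⁻¹ Σ_{ij} |a_{ij}|²·e^{−(β−τ)λ_i}·e^{−τλ_j}` — a positive combination of real exponentials. -/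
theorem lehmann_autocorrelation (hH : H.IsHermitian) (β τ : ℝ) (A : Matrix n n ℂ) :
    gibbsState β H (imagTimeEvolve H (τ : ℂ) A * Aᴴ) =
      (partitionFn β H)⁻¹ * ∑ i, ∑ j,
        ((‖((star hH.eigenvectorUnitary : Matrix n n ℂ) * A * (hH.eigenvectorUnitary : Matrix n n ℂ)) i j‖ ^ 2 : ℝ) : ℂ) *
          ((Real.exp (-(β - τ) * hH.eigenvalues i) : ℝ) : ℂ) * ((Real.exp (-τ * hH.eigenvalues j) : ℝ) : ℂ) := by
  rw [gibbsState_imagTimeEvolve_mul_eq_inv_mul_trace, trace_gibbsWeight_mul_mul_gibbsWeight_mul_eq_sum hH,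
    star_mul_conjTranspose_mul_eq hH]
  congr 1
  refine Finset.sum_congr rfl fun i _ => Finset.sum_congr rfl fun j _ => ?_
  rw [conjTranspose_apply, Complex.star_def]
  set a : ℂ := ((star hH.eigenvectorUnitary : Matrix n n ℂ) * A * (hH.eigenvectorUnitary : Matrix n n ℂ)) i j
  have hsq : a * conj a = ((‖a‖ ^ 2 : ℝ) : ℂ) := by rw [Complex.mul_conj, Complex.normSq_eq_norm_sq]
  calc ((Real.exp (-(β - τ) * hH.eigenvalues i) : ℝ) : ℂ) * a * ((Real.exp (-τ * hH.eigenvalues j) : ℝ) : ℂ) * conj a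
      = (a * conj a) * ((Real.exp (-(β - τ) * hH.eigenvalues i) : ℝ) : ℂ) * ((Real.exp (-τ * hH.eigenvalues j) : ℝ) : ℂ) := by ring
    _ = _ := by rw [hsq]

/-! ## §2 The Lehmann sum of the fermionic Matsubara transform -/

/-- One Lehmann term integrates exactly: for `e^{ikβ} = −1`,
`∫₀^β e^{ikτ}·x·e^{−(β−τ)λ}e^{−τλ'} dτ = −x·(e^{−βλ} + e^{−βλ'})/(ik + λ − λ')` (`x` real). -/
theorem integral_lehmannTerm (β x lam lam' : ℝ) {k : ℝ} (hk : cexp (I * k * β) = -1) :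
    ∫ τ in (0 : ℝ)..β, cexp (I * k * τ) * (((x : ℝ) : ℂ) * ((Real.exp (-(β - τ) * lam) : ℝ) : ℂ) * ((Real.exp (-τ * lam') : ℝ) : ℂ)) =
      -((x : ℂ) * ((Real.exp (-β * lam) + Real.exp (-β * lam') : ℝ) : ℂ) / (I * k + ((lam - lam' : ℝ) : ℂ))) := by
  have hkne : k ≠ 0 := ne_zero_of_cexp_eq_neg_one hk
  set c : ℂ := I * k + ((lam - lam' : ℝ) : ℂ) with hc
  have hcne : c ≠ 0 := by
    intro h
    have := congrArg Complex.im h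
    simp [hc] at this
    exact hkne this
  -- the integrand is a constant times `e^{cτ}`
  have hpt : ∀ τ : ℝ, cexp (I * k * τ) * (((x : ℝ) : ℂ) * ((Real.exp (-(β - τ) * lam) : ℝ) : ℂ) * ((Real.exp (-τ * lam') : ℝ) : ℂ)) =
      ((x : ℂ) * ((Real.exp (-β * lam) : ℝ) : ℂ)) * cexp (c * τ) := by
    intro τ
    have key : cexp (I * k * τ) * (((Real.exp (-(β - τ) * lam) : ℝ) : ℂ) * ((Real.exp (-τ * lam') : ℝ) : ℂ)) =
        ((Real.exp (-β * lam) : ℝ) : ℂ) * cexp (c * τ) := by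
      rw [Complex.ofReal_exp, Complex.ofReal_exp, Complex.ofReal_exp, ← Complex.exp_add, ← Complex.exp_add, ← Complex.exp_add]
      congr 1
      rw [hc]
      push_cast
      ring
    calc cexp (I * k * τ) * (((x : ℝ) : ℂ) * ((Real.exp (-(β - τ) * lam) : ℝ) : ℂ) * ((Real.exp (-τ * lam') : ℝ) : ℂ))
        = (x : ℂ) * (cexp (I * k * τ) * (((Real.exp (-(β - τ) * lam) : ℝ) : ℂ) * ((Real.exp (-τ * lam') : ℝ) : ℂ))) := by ring
      _ = (x : ℂ) * (((Real.exp (-β * lam) : ℝ) : ℂ) * cexp (c * τ)) := by rw [key]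
      _ = ((x : ℂ) * ((Real.exp (-β * lam) : ℝ) : ℂ)) * cexp (c * τ) := by ring
  have hfun : (fun τ : ℝ => cexp (I * k * τ) * (((x : ℝ) : ℂ) * ((Real.exp (-(β - τ) * lam) : ℝ) : ℂ) * ((Real.exp (-τ * lam') : ℝ) : ℂ))) =
      fun τ : ℝ => ((x : ℂ) * ((Real.exp (-β * lam) : ℝ) : ℂ)) * cexp (c * τ) := funext hpt
  rw [hfun, intervalIntegral.integral_const_mul, integral_exp_mul_complex hcne]
  -- evaluate the endpoints: `e^{cβ} = e^{ikβ}·e^{(λ−λ')β} = −e^{(λ−λ')β}`, `e^{c·0} = 1`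
  have hcβ : cexp (c * (β : ℝ)) = -((Real.exp ((lam - lam') * β) : ℝ) : ℂ) := by
    rw [hc, add_mul, Complex.exp_add, hk, Complex.ofReal_exp]
    push_cast
    ring
  have hc0 : cexp (c * ((0 : ℝ) : ℂ)) = 1 := by simp
  rw [hcβ, hc0]
  have hreal : Real.exp (-β * lam) * Real.exp ((lam - lam') * β) = Real.exp (-β * lam') := by
    rw [← Real.exp_add]; congr 1; ring
  rw [show ((Real.exp (-β * lam) + Real.exp (-β * lam') : ℝ) : ℂ) =
      ((Real.exp (-β * lam) : ℝ) : ℂ) * (1 + ((Real.exp ((lam - lam') * β) : ℝ) : ℂ)) by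
    rw [← hreal]; push_cast; ring]
  field_simp
  ring

/-- The Lehmann integrand is continuous in the time. -/
theorem continuous_lehmannTerm (β x lam lam' k : ℝ) :
    Continuous fun τ : ℝ => cexp (I * k * τ) * (((x : ℝ) : ℂ) * ((Real.exp (-(β - τ) * lam) : ℝ) : ℂ) * ((Real.exp (-τ * lam') : ℝ) : ℂ)) := by
  fun_prop

/-- **The Lehmann representation of the fermionic Matsubara transform of an autocorrelation**: for Hermitian `H`, any `A`, real `β` and a
fermionic `k` (`e^{ikβ} = −1`), with `a = U⋆AU`,
`∫₀^β e^{ikτ}⟨A(τ)Aᴴ⟩_β dτ = −Z⁻¹ Σ_{ij} |a_{ij}|²·(e^{−βλ_i} + e^{−βλ_j})/(ik + λ_i − λ_j)`. -/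
theorem matsubara_autocorrelation_eq_lehmann (hH : H.IsHermitian) (β : ℝ) (A : Matrix n n ℂ) {k : ℝ} (hk : cexp (I * k * β) = -1) :
    ∫ τ in (0 : ℝ)..β, cexp (I * k * τ) * gibbsState β H (imagTimeEvolve H (τ : ℂ) A * Aᴴ) =
      -(partitionFn β H)⁻¹ * ∑ i, ∑ j,
        ((‖((star hH.eigenvectorUnitary : Matrix n n ℂ) * A * (hH.eigenvectorUnitary : Matrix n n ℂ)) i j‖ ^ 2 : ℝ) : ℂ) *
            ((Real.exp (-β * hH.eigenvalues i) + Real.exp (-β * hH.eigenvalues j) : ℝ) : ℂ) /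
          (I * k + ((hH.eigenvalues i - hH.eigenvalues j : ℝ) : ℂ)) := by
  set a : Matrix n n ℂ := ((star hH.eigenvectorUnitary : Matrix n n ℂ) * A * (hH.eigenvectorUnitary : Matrix n n ℂ)) with ha
  -- expand the integrand and push the phase inside the double sum
  have hpt : ∀ τ : ℝ, cexp (I * k * τ) * gibbsState β H (imagTimeEvolve H (τ : ℂ) A * Aᴴ) =
      (partitionFn β H)⁻¹ * ∑ i, ∑ j, cexp (I * k * τ) *
        (((‖a i j‖ ^ 2 : ℝ) : ℂ) * ((Real.exp (-(β - τ) * hH.eigenvalues i) : ℝ) : ℂ) * ((Real.exp (-τ * hH.eigenvalues j) : ℝ) : ℂ)) := by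
    intro τ
    rw [lehmann_autocorrelation hH β τ A, ← ha, mul_left_comm]
    congr 1
    rw [Finset.mul_sum]
    refine Finset.sum_congr rfl fun i _ => ?_
    rw [Finset.mul_sum]
  have hint : ∀ i j, IntervalIntegrable (fun τ : ℝ => cexp (I * k * τ) *
      (((‖a i j‖ ^ 2 : ℝ) : ℂ) * ((Real.exp (-(β - τ) * hH.eigenvalues i) : ℝ) : ℂ) * ((Real.exp (-τ * hH.eigenvalues j) : ℝ) : ℂ)))
      volume 0 β := fun i j => (continuous_lehmannTerm β _ _ _ k).intervalIntegrable _ _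
  have hcont : ∀ i, Continuous fun τ : ℝ => ∑ j, cexp (I * k * τ) *
      (((‖a i j‖ ^ 2 : ℝ) : ℂ) * ((Real.exp (-(β - τ) * hH.eigenvalues i) : ℝ) : ℂ) * ((Real.exp (-τ * hH.eigenvalues j) : ℝ) : ℂ)) :=
    fun i => continuous_finsetSum _ fun j _ => continuous_lehmannTerm β _ _ _ k
  simp_rw [hpt]
  rw [intervalIntegral.integral_const_mul, intervalIntegral.integral_finsetSum (fun i _ => (hcont i).intervalIntegrable _ _)]
  rw [neg_mul, ← mul_neg, ← Finset.sum_neg_distrib]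
  congr 1
  refine Finset.sum_congr rfl fun i _ => ?_
  rw [intervalIntegral.integral_finsetSum (fun j _ => hint i j), ← Finset.sum_neg_distrib]
  refine Finset.sum_congr rfl fun j _ => ?_
  rw [integral_lehmannTerm β _ _ _ hk]

/-! ## §3 The decay bound: positivity of the spectral weights, `|ik + Δ| ≥ |k|` -/

/-- `|k| ≤ |ik + Δ|` for real `k, Δ`. -/
theorem abs_le_norm_I_mul_add_real (k Δ : ℝ) : |k| ≤ ‖I * k + (Δ : ℂ)‖ := by
  have h := Complex.abs_im_le_norm (I * k + (Δ : ℂ))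
  simpa using h

/-- **LEHMANN DECAY OF A FERMIONIC MATSUBARA TRANSFORM OF AN AUTOCORRELATION.**  For Hermitian `H`, any matrix `A`, real `β` and a fermionic
frequency `k` (`e^{ikβ} = −1`): `‖∫₀^β e^{ikτ}⟨A(τ)Aᴴ⟩_β dτ‖ ≤ 2‖A‖²/|k|` — the total spectral weight is `⟨AAᴴ⟩ + ⟨AᴴA⟩ ≤ 2‖A‖²`; no commutator
of `A` with `H` enters (contrast `norm_fermionic_matsubara_sub_sumRules_le`). -/
theorem norm_matsubara_autocorrelation_le (hH : H.IsHermitian) [Nonempty n] (β : ℝ) (A : Matrix n n ℂ) {k : ℝ}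
    (hk : cexp (I * k * β) = -1) :
    ‖∫ τ in (0 : ℝ)..β, cexp (I * k * τ) * gibbsState β H (imagTimeEvolve H (τ : ℂ) A * Aᴴ)‖ ≤ 2 * ‖A‖ ^ 2 / |k| := by
  have hkne : k ≠ 0 := ne_zero_of_cexp_eq_neg_one hk
  have hk0 : 0 < |k| := abs_pos.mpr hkne
  rw [matsubara_autocorrelation_eq_lehmann hH β A hk]
  set a : Matrix n n ℂ := ((star hH.eigenvectorUnitary : Matrix n n ℂ) * A * (hH.eigenvectorUnitary : Matrix n n ℂ)) with ha
  set lam : n → ℝ := hH.eigenvalues with hlam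
  -- the partition function is a positive real
  set Zr : ℝ := ∑ i, Real.exp (-(β * lam i)) with hZr
  have hZpos : 0 < Zr := hH.sum_exp_pos β
  have hZ : partitionFn β H = (Zr : ℂ) := hH.partitionFn_eq_ofReal β
  have hZre : (partitionFn β H).re = Zr := by rw [hZ, Complex.ofReal_re]
  -- the two spectral sums are `Re Tr(e^{−βH}AAᴴ)` and `Re Tr(e^{−βH}AᴴA)`, each `≤ ‖A‖²·Z`
  set S₁ : ℝ := ∑ i, ∑ j, Real.exp (-β * lam i) * ‖a i j‖ ^ 2 with hS₁
  set S₂ : ℝ := ∑ i, ∑ j, Real.exp (-β * lam j) * ‖a i j‖ ^ 2 with hS₂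
  have hAA : ‖A * Aᴴ‖ ≤ ‖A‖ ^ 2 := by
    rw [sq]; exact (norm_mul_le _ _).trans (by rw [Matrix.l2_opNorm_conjTranspose])
  have hAA' : ‖Aᴴ * A‖ ≤ ‖A‖ ^ 2 := by
    rw [sq]; exact (norm_mul_le _ _).trans (by rw [Matrix.l2_opNorm_conjTranspose])
  have hS₁le : S₁ ≤ ‖A‖ ^ 2 * Zr := by
    have h := re_trace_gibbsWeight_mul_le hH β (A * Aᴴ)
    rw [re_trace_gibbsWeight_mul_mul_conjTranspose hH β A, hZre] at h
    exact h.trans (mul_le_mul_of_nonneg_right hAA hZpos.le)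
  have hS₂le : S₂ ≤ ‖A‖ ^ 2 * Zr := by
    have h := re_trace_gibbsWeight_mul_le hH β (Aᴴ * A)
    rw [re_trace_gibbsWeight_mul_conjTranspose_mul hH β A, hZre] at h
    exact h.trans (mul_le_mul_of_nonneg_right hAA' hZpos.le)
  -- termwise bound of the Lehmann sum
  have hterm : ∀ i j, ‖((‖a i j‖ ^ 2 : ℝ) : ℂ) * ((Real.exp (-β * lam i) + Real.exp (-β * lam j) : ℝ) : ℂ) /
      (I * k + ((lam i - lam j : ℝ) : ℂ))‖ ≤ (Real.exp (-β * lam i) * ‖a i j‖ ^ 2 + Real.exp (-β * lam j) * ‖a i j‖ ^ 2) / |k| := by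
    intro i j
    rw [norm_div, norm_mul, Complex.norm_real, Complex.norm_real, Real.norm_of_nonneg (sq_nonneg _),
      Real.norm_of_nonneg (by positivity)]
    calc ‖a i j‖ ^ 2 * (Real.exp (-β * lam i) + Real.exp (-β * lam j)) / ‖I * k + ((lam i - lam j : ℝ) : ℂ)‖
        ≤ ‖a i j‖ ^ 2 * (Real.exp (-β * lam i) + Real.exp (-β * lam j)) / |k| :=
          div_le_div_of_nonneg_left (by positivity) hk0 (abs_le_norm_I_mul_add_real k _)
      _ = (Real.exp (-β * lam i) * ‖a i j‖ ^ 2 + Real.exp (-β * lam j) * ‖a i j‖ ^ 2) / |k| := by ring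
  have hsum : ‖∑ i, ∑ j, ((‖a i j‖ ^ 2 : ℝ) : ℂ) * ((Real.exp (-β * lam i) + Real.exp (-β * lam j) : ℝ) : ℂ) /
      (I * k + ((lam i - lam j : ℝ) : ℂ))‖ ≤ (S₁ + S₂) / |k| := by
    calc ‖∑ i, ∑ j, ((‖a i j‖ ^ 2 : ℝ) : ℂ) * ((Real.exp (-β * lam i) + Real.exp (-β * lam j) : ℝ) : ℂ) /
          (I * k + ((lam i - lam j : ℝ) : ℂ))‖
        ≤ ∑ i, ∑ j, (Real.exp (-β * lam i) * ‖a i j‖ ^ 2 + Real.exp (-β * lam j) * ‖a i j‖ ^ 2) / |k| :=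
          (norm_sum_le _ _).trans (Finset.sum_le_sum fun i _ => (norm_sum_le _ _).trans (Finset.sum_le_sum fun j _ => hterm i j))
      _ = (S₁ + S₂) / |k| := by
          rw [hS₁, hS₂, ← Finset.sum_add_distrib, Finset.sum_div]
          refine Finset.sum_congr rfl fun i _ => ?_
          rw [← Finset.sum_add_distrib, Finset.sum_div]
  -- assemble
  rw [norm_mul, norm_neg, norm_inv, hZ, Complex.norm_real, Real.norm_of_nonneg hZpos.le]
  calc Zr⁻¹ * ‖∑ i, ∑ j, ((‖a i j‖ ^ 2 : ℝ) : ℂ) * ((Real.exp (-β * lam i) + Real.exp (-β * lam j) : ℝ) : ℂ) /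
          (I * k + ((lam i - lam j : ℝ) : ℂ))‖
      ≤ Zr⁻¹ * ((S₁ + S₂) / |k|) := mul_le_mul_of_nonneg_left hsum (inv_nonneg.mpr hZpos.le)
    _ ≤ Zr⁻¹ * ((‖A‖ ^ 2 * Zr + ‖A‖ ^ 2 * Zr) / |k|) := by gcongr
    _ = 2 * ‖A‖ ^ 2 / |k| := by field_simp; ring

/-- The same at the tree's fermionic frequencies `k = π(2m+1)/β` (`β > 0`):
`‖∫₀^β e^{ik_mτ}⟨A(τ)Aᴴ⟩_β dτ‖ ≤ 2‖A‖²/|k_m| ≤ 2‖A‖²·β/π`. -/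
theorem norm_matsubara_autocorrelation_le_fermi (hH : H.IsHermitian) [Nonempty n] {β : ℝ} (hβ : 0 < β) (A : Matrix n n ℂ) (m : ℤ) :
    ‖∫ τ in (0 : ℝ)..β, cexp (I * (fermiMatsubara β m : ℝ) * τ) * gibbsState β H (imagTimeEvolve H (τ : ℂ) A * Aᴴ)‖ ≤
      2 * ‖A‖ ^ 2 / |fermiMatsubara β m| :=
  norm_matsubara_autocorrelation_le hH β A (cexp_fermiMatsubara_mul_beta hβ.ne' m)

end Summit.HubbardSuperconductivity.HubbardSuperconductivity.Theorems.ThermalGreen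

end
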